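import Summits.Ventures.Crystal3D.Theorems.StickyWulffConstantTextureLiminfTexShadowCertificateDefs
import Summits.Ventures.Crystal3D.Theorems.StickyWulffConstantTextureLiminfTentFrame
import Literature.MathematicalPhysics.StatisticalMechanics.BarlowCovering
import Literature.MathematicalPhysics.StatisticalMechanics.BarlowCoordination
import HarnessLib

/-!
# TB-D: DISTANCE SHELLS of a moved Barlow stacking — `1`, `√2`, `≥ √(8/3)` — the covering radius `1/√2`, and the octahedron spanned by a `√2`-pair
# (lane T, crux `TextureLiminfV5`, stmt-Ventures-23912; design memo TB-D-0 §3 (mass without Kepler), §5; helper seat wulff-tb-w1; part 1 of the MASS bricks)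

HONEST FRAMING. Venture `Summits/Ventures/Crystal3D` (cell `crystal3d-full`), route `route-Ventures-StickyWulffConstant`, helper
`--supports` the law-v5 crux `TextureLiminfV5` (stmt-Ventures-23912).  Elementary metric geometry of the moved Barlow stackings
`stacking L s σ` of the line (census-free, standard axioms); nothing about any texture, cover or mesh; F-C1 not moved.  Consumed by
`…TextureBuildMassCells` ((M2) no foreign balls near a locally perfect site, (M3) the twelve-neighbour cell lies in `ball a (√2/2)`).

* `inLayer_form_eq_twelve_or_le`, `adjLayer_form_eq_or_le`, `adjLayer_form_eq_sixteen`, **`form_trichotomy`** — the integer form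
  `3(2P+Q+Λ)² + (3Q+Λ)² + 8K²` of lit `twelve_mul_dist_barlowPos_sq` (`= 12·dist²` at the ideal spacing) is `12`, `24` or `≥ 32` off the diagonal;
* **`dist_trichotomy_of_mem_stacking`** — two distinct sites of `stacking L s σ` (Hägg `σ`) are at distance `1`, `√2`, or `≥ √(8/3)`;
  `sqrt_two_le_dist_of_mem_stacking` (the SECOND SHELL is at `√2`), `one_le_dist_of_mem_stacking` (packing, lit, moved);
* `exists_mem_stacking_dist_sq_le_half` — lit covering radius `1/√2` (`exists_mem_barlowStacking_dist_sq_le`), moved;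
* **`exists_common_neighbours_of_dist_eq_sqrt_two`** — two sites at distance `√2` are opposite vertices of an octahedron of the stacking: they have two
  common nearest neighbours `v, v'` with `v + v' = a + b` (an antipodal pair of the equatorial square); coordinates: `exists_common_neighbours_succ`,
  `exists_common_neighbours_barlowPos`.
-/

noncomputable section

open scoped BigOperators InnerProductSpace

namespace Summit.Ventures.Crystal3D.Cruxes.TextureLiminf.TexShadow

open Summit.Ventures.Crystal3D Metric
open Summit.Ventures.Crystal3D.TentCertificate (hB hB_sq hB_pos)
open Literature.MathematicalPhysics.StatisticalMechanics (barlowPos barlowStacking barlowPos_mem IsHaggSeq haggLabel haggLabel_succ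
  sixOffsets threeOffsets dist_barlowPos_eq_iff twelve_mul_dist_barlowPos_sq haggLabel_sub_haggLabel_succ haggLabel_sub_haggLabel_pred
  exists_mem_barlowStacking_dist_sq_le barlowPos_apply_zero barlowPos_apply_one barlowPos_apply_two le_dist_of_mem_barlowStacking_ideal
  mem_barlowStacking_iff)

/-! ### Integer shell forms: `12`, `24`, or `≥ 32` -/

/-- In-layer form off the origin: `3(2P+Q)² + (3Q)² = 12(P² + PQ + Q²)` is `12` or `≥ 36` (`2` is not a Löschian number). -/
theorem inLayer_form_eq_twelve_or_le {P Q : ℤ} (h : P ≠ 0 ∨ Q ≠ 0) :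
    3 * (2 * P + Q) ^ 2 + (3 * Q) ^ 2 = 12 ∨ 36 ≤ 3 * (2 * P + Q) ^ 2 + (3 * Q) ^ 2 := by
  by_contra hc
  push Not at hc
  obtain ⟨h1, h2⟩ := hc
  have hQ : (3 * Q) ^ 2 < 36 := by nlinarith [sq_nonneg (2 * P + Q)]
  have hQ1 : 3 * Q ≤ 5 := by nlinarith
  have hQ2 : -5 ≤ 3 * Q := by nlinarith
  have hu : (2 * P + Q) ^ 2 < 12 := by nlinarith [sq_nonneg (3 * Q)]
  have hu1 : 2 * P + Q ≤ 3 := by nlinarith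
  have hu2 : -3 ≤ 2 * P + Q := by nlinarith
  have hQ3 : -1 ≤ Q := by omega
  have hQ4 : Q ≤ 1 := by omega
  have hP1 : -2 ≤ P := by omega
  have hP2 : P ≤ 2 := by omega
  interval_cases Q <;> interval_cases P <;> omega

/-- Adjacent-layer form (letter shift `Λ = ±1`): `3(2P+Q+Λ)² + (3Q+Λ)²` is `4`, `16`, or `≥ 24`. -/
theorem adjLayer_form_eq_or_le {P Q Λ : ℤ} (hΛ : Λ = 1 ∨ Λ = -1) :
    3 * (2 * P + Q + Λ) ^ 2 + (3 * Q + Λ) ^ 2 = 4 ∨ 3 * (2 * P + Q + Λ) ^ 2 + (3 * Q + Λ) ^ 2 = 16 ∨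
      24 ≤ 3 * (2 * P + Q + Λ) ^ 2 + (3 * Q + Λ) ^ 2 := by
  by_contra hc
  push Not at hc
  obtain ⟨h1, h2, h3⟩ := hc
  have hv : (3 * Q + Λ) ^ 2 < 24 := by nlinarith [sq_nonneg (2 * P + Q + Λ)]
  have hv1 : 3 * Q + Λ ≤ 4 := by nlinarith
  have hv2 : -4 ≤ 3 * Q + Λ := by nlinarith
  have hu : (2 * P + Q + Λ) ^ 2 < 8 := by nlinarith [sq_nonneg (3 * Q + Λ)]
  have hu1 : 2 * P + Q + Λ ≤ 2 := by nlinarith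
  have hu2 : -2 ≤ 2 * P + Q + Λ := by nlinarith
  rcases hΛ with rfl | rfl
  · have hQ3 : -1 ≤ Q := by omega
    have hQ4 : Q ≤ 1 := by omega
    have hP1 : -2 ≤ P := by omega
    have hP2 : P ≤ 1 := by omega
    interval_cases Q <;> interval_cases P <;> omega
  · have hQ3 : -1 ≤ Q := by omega
    have hQ4 : Q ≤ 1 := by omega
    have hP1 : -1 ≤ P := by omega
    have hP2 : P ≤ 2 := by omega
    interval_cases Q <;> interval_cases P <;> omega

/-- Adjacent-layer form `= 16` pins the offset: `(P, Q) ∈ {(-Λ, Λ), (Λ, -Λ), (-Λ, -Λ)}` — the three `√2`-neighbours across an octahedral hole. -/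
theorem adjLayer_form_eq_sixteen {P Q Λ : ℤ} (hΛ : Λ = 1 ∨ Λ = -1) (h16 : 3 * (2 * P + Q + Λ) ^ 2 + (3 * Q + Λ) ^ 2 = 16) :
    (P = -Λ ∧ Q = Λ) ∨ (P = Λ ∧ Q = -Λ) ∨ (P = -Λ ∧ Q = -Λ) := by
  have hv : (3 * Q + Λ) ^ 2 ≤ 16 := by nlinarith [sq_nonneg (2 * P + Q + Λ)]
  have hv1 : 3 * Q + Λ ≤ 4 := by nlinarith
  have hv2 : -4 ≤ 3 * Q + Λ := by nlinarith
  have hu : (2 * P + Q + Λ) ^ 2 ≤ 5 := by nlinarith [sq_nonneg (3 * Q + Λ)]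
  have hu1 : 2 * P + Q + Λ ≤ 2 := by nlinarith
  have hu2 : -2 ≤ 2 * P + Q + Λ := by nlinarith
  rcases hΛ with rfl | rfl
  · have hQ3 : -1 ≤ Q := by omega
    have hQ4 : Q ≤ 1 := by omega
    have hP1 : -2 ≤ P := by omega
    have hP2 : P ≤ 1 := by omega
    interval_cases Q <;> interval_cases P <;> omega
  · have hQ3 : -1 ≤ Q := by omega
    have hQ4 : Q ≤ 1 := by omega
    have hP1 : -1 ≤ P := by omega
    have hP2 : P ≤ 2 := by omega
    interval_cases Q <;> interval_cases P <;> omega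

/-- **The shell form of a Hägg stacking is `12`, `24`, or `≥ 32`** off the diagonal (`F = 12·dist²` for the ideal spacing, so the distances of
the stacking are `1`, `√2`, `≥ √(8/3)`; `√(8/3)` occurs only at hcp-like sites, `√3` is the next fcc distance). -/
theorem form_trichotomy {s : ℤ → ℤ} (hs : IsHaggSeq s) {k i j k' i' j' : ℤ} (hne : (k, i, j) ≠ (k', i', j')) :
    3 * (2 * (i - i') + (j - j') + (haggLabel s k - haggLabel s k')) ^ 2 + (3 * (j - j') + (haggLabel s k - haggLabel s k')) ^ 2 +
        8 * (k - k') ^ 2 = 12 ∨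
      3 * (2 * (i - i') + (j - j') + (haggLabel s k - haggLabel s k')) ^ 2 + (3 * (j - j') + (haggLabel s k - haggLabel s k')) ^ 2 +
        8 * (k - k') ^ 2 = 24 ∨
      32 ≤ 3 * (2 * (i - i') + (j - j') + (haggLabel s k - haggLabel s k')) ^ 2 +
        (3 * (j - j') + (haggLabel s k - haggLabel s k')) ^ 2 + 8 * (k - k') ^ 2 := by
  set Λ : ℤ := haggLabel s k - haggLabel s k' with hΛ
  rcases lt_trichotomy (k - k') 0 with hK | hK | hK
  · rcases eq_or_lt_of_le (Int.le_sub_one_iff.2 hK : k - k' ≤ -1) with hK1 | hK1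
    · -- `k' = k + 1`, `Λ = -s k`
      have hk' : k' = k + 1 := by omega
      have hΛ' : Λ = -s k := by rw [hΛ, hk', haggLabel_sub_haggLabel_succ]
      have hσ : -s k = 1 ∨ -s k = -1 := by rcases hs k with h1 | h1 <;> omega
      have hK8 : (8 : ℤ) * (k - k') ^ 2 = 8 := by rw [hK1]; norm_num
      rcases adjLayer_form_eq_or_le (P := i - i') (Q := j - j') hσ with h | h | h
      · left; rw [hΛ', hK8]; omega
      · right; left; rw [hΛ', hK8]; omega
      · right; right; rw [hΛ', hK8]; omega
    · right; right
      have hK2 : 4 ≤ (k - k') ^ 2 := by nlinarith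
      nlinarith [sq_nonneg (2 * (i - i') + (j - j') + Λ), sq_nonneg (3 * (j - j') + Λ)]
  · -- same layer, `Λ = 0`
    have hk' : k' = k := by omega
    have hΛ0 : Λ = 0 := by rw [hΛ, hk', sub_self]
    have hPQ : i - i' ≠ 0 ∨ j - j' ≠ 0 := by
      by_contra h0
      push Not at h0
      exact hne (by rw [hk', show i = i' by omega, show j = j' by omega])
    rcases inLayer_form_eq_twelve_or_le hPQ with h | h
    · left; rw [hΛ0, hK]; simpa using h
    · right; right; rw [hΛ0, hK]; simp only [add_zero] at h ⊢; omega
  · rcases eq_or_lt_of_le (Int.add_one_le_iff.2 hK : 1 ≤ k - k') with hK1 | hK1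
    · -- `k' = k - 1`, `Λ = s (k-1)`
      have hk' : k' = k - 1 := by omega
      have hΛ' : Λ = s (k - 1) := by rw [hΛ, hk', haggLabel_sub_haggLabel_pred]
      have hσ : s (k - 1) = 1 ∨ s (k - 1) = -1 := hs (k - 1)
      have hK8 : (8 : ℤ) * (k - k') ^ 2 = 8 := by rw [← hK1]; norm_num
      rcases adjLayer_form_eq_or_le (P := i - i') (Q := j - j') hσ with h | h | h
      · left; rw [hΛ', hK8]; omega
      · right; left; rw [hΛ', hK8]; omega
      · right; right; rw [hΛ', hK8]; omega
    · right; right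
      have hK2 : 4 ≤ (k - k') ^ 2 := by nlinarith
      nlinarith [sq_nonneg (2 * (i - i') + (j - j') + Λ), sq_nonneg (3 * (j - j') + Λ)]

/-- The ideal spacing: `(√(2/3))² = 2/3 · 1²`. -/
theorem hB_sq' : hB ^ 2 = 2 / 3 * (1 : ℝ) ^ 2 := by rw [hB_sq]; ring

/-- **Distance trichotomy in a Barlow stacking** (coordinates): two distinct sites are at distance `1`, `√2`, or squared distance `≥ 8/3`. -/
theorem dist_barlowPos_trichotomy {s : ℤ → ℤ} (hs : IsHaggSeq s) {k i j k' i' j' : ℤ} (hne : (k, i, j) ≠ (k', i', j')) :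
    dist (barlowPos 1 hB s k i j) (barlowPos 1 hB s k' i' j') = 1 ∨
      dist (barlowPos 1 hB s k i j) (barlowPos 1 hB s k' i' j') = Real.sqrt 2 ∨
      8 / 3 ≤ dist (barlowPos 1 hB s k i j) (barlowPos 1 hB s k' i' j') ^ 2 := by
  have h12 := twelve_mul_dist_barlowPos_sq hB_sq' s k i j k' i' j'
  rw [one_pow, one_mul] at h12
  set d := dist (barlowPos 1 hB s k i j) (barlowPos 1 hB s k' i' j') with hd
  have hd0 : 0 ≤ d := dist_nonneg
  rcases form_trichotomy hs hne with h | h | h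
  · left
    rw [h] at h12; push_cast at h12
    have : d ^ 2 = 1 := by linarith
    nlinarith
  · right; left
    rw [h] at h12; push_cast at h12
    have h2 : d ^ 2 = 2 := by linarith
    rw [← Real.sqrt_sq hd0, h2]
  · right; right
    have h' : (32 : ℝ) ≤ ((3 * (2 * (i - i') + (j - j') + (haggLabel s k - haggLabel s k')) ^ 2 +
        (3 * (j - j') + (haggLabel s k - haggLabel s k')) ^ 2 + 8 * (k - k') ^ 2 : ℤ) : ℝ) := by exact_mod_cast h
    linarith

/-- Distances are preserved by the frame map `r ↦ L r + s`. -/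
theorem dist_move (L : E3 ≃ₗᵢ[ℝ] E3) (s r r' : E3) : dist (L r + s) (L r' + s) = dist r r' := by
  rw [dist_add_right, LinearIsometryEquiv.dist_map]

/-- **Distance trichotomy in a moved Barlow stacking**: distinct sites of `stacking L s σ` are at distance `1`, `√2`, or `≥ √(8/3)`. -/
theorem dist_trichotomy_of_mem_stacking {σ : ℤ → ℤ} (hσ : IsHaggSeq σ) {L : E3 ≃ₗᵢ[ℝ] E3} {s : E3} {v w : E3}
    (hv : v ∈ stacking L s σ) (hw : w ∈ stacking L s σ) (hne : v ≠ w) :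
    dist v w = 1 ∨ dist v w = Real.sqrt 2 ∨ 8 / 3 ≤ dist v w ^ 2 := by
  obtain ⟨r, hr, rfl⟩ := hv
  obtain ⟨r', hr', rfl⟩ := hw
  obtain ⟨k, i, j, rfl⟩ := mem_barlowStacking_iff.1 hr
  obtain ⟨k', i', j', rfl⟩ := mem_barlowStacking_iff.1 hr'
  rw [dist_move]
  refine dist_barlowPos_trichotomy hσ ?_
  rintro h
  simp only [Prod.mk.injEq] at h
  obtain ⟨rfl, rfl, rfl⟩ := h
  exact hne rfl

/-- **The second shell is at `√2`**: two distinct sites not at distance `1` are at distance `≥ √2`. -/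
theorem sqrt_two_le_dist_of_mem_stacking {σ : ℤ → ℤ} (hσ : IsHaggSeq σ) {L : E3 ≃ₗᵢ[ℝ] E3} {s : E3} {v w : E3}
    (hv : v ∈ stacking L s σ) (hw : w ∈ stacking L s σ) (hne : v ≠ w) (h1 : dist v w ≠ 1) : Real.sqrt 2 ≤ dist v w := by
  rcases dist_trichotomy_of_mem_stacking hσ hv hw hne with h | h | h
  · exact absurd h h1
  · exact h.ge
  · have h2 : (Real.sqrt 2) ^ 2 ≤ dist v w ^ 2 := by rw [Real.sq_sqrt (by norm_num : (0:ℝ) ≤ 2)]; linarith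
    exact (pow_le_pow_iff_left₀ (Real.sqrt_nonneg 2) dist_nonneg two_ne_zero).1 h2

/-- Distinct sites of a moved stacking are at distance `≥ 1` (lit `le_dist_of_mem_barlowStacking_ideal`, moved). -/
theorem one_le_dist_of_mem_stacking {σ : ℤ → ℤ} (hσ : IsHaggSeq σ) {L : E3 ≃ₗᵢ[ℝ] E3} {s : E3} {v w : E3}
    (hv : v ∈ stacking L s σ) (hw : w ∈ stacking L s σ) (hne : v ≠ w) : 1 ≤ dist v w := by
  obtain ⟨r, hr, rfl⟩ := hv
  obtain ⟨r', hr', rfl⟩ := hw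
  rw [dist_move]
  exact le_dist_of_mem_barlowStacking_ideal hσ one_pos hB_sq' hr hr' fun h => hne (by rw [h])

/-- **Covering radius `1/√2`, moved**: every point is within squared distance `1/2` of `stacking L s σ` (lit `exists_mem_barlowStacking_dist_sq_le`). -/
theorem exists_mem_stacking_dist_sq_le_half (L : E3 ≃ₗᵢ[ℝ] E3) (s : E3) (σ : ℤ → ℤ) (p : E3) :
    ∃ b ∈ stacking L s σ, dist p b ^ 2 ≤ 1 / 2 := by
  obtain ⟨z, hz, hd⟩ := exists_mem_barlowStacking_dist_sq_le (a := (1 : ℝ)) one_ne_zero hB_pos σ (L.symm (p - s))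
  refine ⟨L z + s, ⟨z, hz, rfl⟩, ?_⟩
  have hp : dist p (L z + s) = dist (L.symm (p - s)) z := by
    conv_lhs => rw [show p = L (L.symm (p - s)) + s by simp]
    rw [dist_move]
  rw [hp]
  calc dist (L.symm (p - s)) z ^ 2 ≤ 1 ^ 2 / 3 + hB ^ 2 / 4 := hd
    _ = 1 / 2 := by rw [hB_sq]; norm_num

/-! ### Two sites at distance `√2` span an octahedron -/

/-- Swapping the layers of two sites does not change their sum (the position is affine in the indices, layer by layer). -/
theorem barlowPos_add_swap (s : ℤ → ℤ) (k₁ k₂ i₁ j₁ i₂ j₂ : ℤ) :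
    barlowPos 1 hB s k₁ i₁ j₁ + barlowPos 1 hB s k₂ i₂ j₂ = barlowPos 1 hB s k₂ i₁ j₁ + barlowPos 1 hB s k₁ i₂ j₂ := by
  ext l
  fin_cases l <;> simp <;> ring

/-- Re-indexing a sum of two sites of layers `k₁, k₂`: only the index sums matter. -/
theorem barlowPos_add_eq_of_index_sums (s : ℤ → ℤ) (k₁ k₂ : ℤ) {i₁ j₁ i₂ j₂ i₃ j₃ i₄ j₄ : ℤ} (hi : i₁ + i₂ = i₃ + i₄)
    (hj : j₁ + j₂ = j₃ + j₄) :
    barlowPos 1 hB s k₁ i₁ j₁ + barlowPos 1 hB s k₂ i₂ j₂ = barlowPos 1 hB s k₁ i₃ j₃ + barlowPos 1 hB s k₂ i₄ j₄ := by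
  have hi' : (i₁ : ℝ) + i₂ = i₃ + i₄ := by exact_mod_cast hi
  have hj' : (j₁ : ℝ) + j₂ = j₃ + j₄ := by exact_mod_cast hj
  ext l
  fin_cases l
  · simp; linear_combination (1 : ℝ) * hi' + (1 / 2 : ℝ) * hj'
  · simp; linear_combination (Real.sqrt 3 / 2 : ℝ) * hj'
  · simp

/-- The octahedron lemma in coordinates, lower site first: if `b = barlowPos (k+1) i' j'` is at distance `√2` from `a = barlowPos k i j`, there are
two common nearest neighbours `v` (layer `k+1`) and `v'` (layer `k`) with `v + v' = a + b`. -/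
theorem exists_common_neighbours_succ {s : ℤ → ℤ} (hs : IsHaggSeq s) (k i j i' j' : ℤ)
    (hd : dist (barlowPos 1 hB s k i j) (barlowPos 1 hB s (k + 1) i' j') = Real.sqrt 2) :
    ∃ v v' : E3, v ∈ barlowStacking 1 hB s ∧ v' ∈ barlowStacking 1 hB s ∧
      dist (barlowPos 1 hB s k i j) v = 1 ∧ dist (barlowPos 1 hB s (k + 1) i' j') v = 1 ∧
      dist (barlowPos 1 hB s k i j) v' = 1 ∧ dist (barlowPos 1 hB s (k + 1) i' j') v' = 1 ∧
      v + v' = barlowPos 1 hB s k i j + barlowPos 1 hB s (k + 1) i' j' := by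
  -- the form is `24`, i.e. the adjacent-layer form is `16`
  have h12 := twelve_mul_dist_barlowPos_sq hB_sq' s k i j (k + 1) i' j'
  rw [one_pow, one_mul, hd, Real.sq_sqrt (by norm_num : (0:ℝ) ≤ 2), haggLabel_sub_haggLabel_succ] at h12
  have hF : 3 * (2 * (i - i') + (j - j') + -s k) ^ 2 + (3 * (j - j') + -s k) ^ 2 + 8 * (k - (k + 1)) ^ 2 = (24 : ℤ) := by
    exact_mod_cast h12.symm
  have h16 : 3 * (2 * (i - i') + (j - j') + -s k) ^ 2 + (3 * (j - j') + -s k) ^ 2 = 16 := by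
    have : (8 : ℤ) * (k - (k + 1)) ^ 2 = 8 := by norm_num
    omega
  have hΛ : -s k = 1 ∨ -s k = -1 := by rcases hs k with h | h <;> omega
  have hsk : s (k + 1 - 1) = s k := by rw [add_sub_cancel_right]
  -- membership facts in the offset sets, for `Λ = -s k = ±1`
  have h00a : ((0 : ℤ), (0 : ℤ)) ∈ threeOffsets (-s k) := by
    rcases hΛ with h | h <;> rw [h] <;> decide
  have h00b : ((0 : ℤ), (0 : ℤ)) ∈ threeOffsets (s (k + 1 - 1)) := by
    rw [hsk]; rcases hs k with h | h <;> rw [h] <;> decide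
  rcases adjLayer_form_eq_sixteen hΛ h16 with ⟨hP, hQ⟩ | ⟨hP, hQ⟩ | ⟨hP, hQ⟩
  · -- `(P, Q) = (-Λ, Λ)`: `v = (k+1, i, j)`, `v' = (k, i', j')`
    refine ⟨barlowPos 1 hB s (k + 1) i j, barlowPos 1 hB s k i' j', barlowPos_mem _ _ _, barlowPos_mem _ _ _, ?_, ?_, ?_, ?_, ?_⟩
    · rw [dist_barlowPos_eq_iff hs one_pos hB_sq']
      exact Or.inr (Or.inl ⟨rfl, by simpa using h00a⟩)
    · rw [dist_barlowPos_eq_iff hs one_pos hB_sq']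
      refine Or.inl ⟨rfl, ?_⟩
      have e1 : i' - i = -s k := by omega
      have e2 : j' - j = s k := by omega
      rw [e1, e2]; rcases hs k with h | h <;> rw [h] <;> decide
    · rw [dist_barlowPos_eq_iff hs one_pos hB_sq']
      refine Or.inl ⟨rfl, ?_⟩
      rw [hP, hQ]; rcases hΛ with h | h <;> rw [h] <;> decide
    · rw [dist_barlowPos_eq_iff hs one_pos hB_sq']
      exact Or.inr (Or.inr ⟨by ring, by simpa using h00b⟩)
    · exact barlowPos_add_swap s (k + 1) k i j i' j'
  · -- `(P, Q) = (Λ, -Λ)`: the same pair `v = (k+1, i, j)`, `v' = (k, i', j')`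
    refine ⟨barlowPos 1 hB s (k + 1) i j, barlowPos 1 hB s k i' j', barlowPos_mem _ _ _, barlowPos_mem _ _ _, ?_, ?_, ?_, ?_, ?_⟩
    · rw [dist_barlowPos_eq_iff hs one_pos hB_sq']
      exact Or.inr (Or.inl ⟨rfl, by simpa using h00a⟩)
    · rw [dist_barlowPos_eq_iff hs one_pos hB_sq']
      refine Or.inl ⟨rfl, ?_⟩
      have e1 : i' - i = s k := by omega
      have e2 : j' - j = -s k := by omega
      rw [e1, e2]; rcases hs k with h | h <;> rw [h] <;> decide
    · rw [dist_barlowPos_eq_iff hs one_pos hB_sq']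
      refine Or.inl ⟨rfl, ?_⟩
      rw [hP, hQ]; rcases hΛ with h | h <;> rw [h] <;> decide
    · rw [dist_barlowPos_eq_iff hs one_pos hB_sq']
      exact Or.inr (Or.inr ⟨by ring, by simpa using h00b⟩)
    · exact barlowPos_add_swap s (k + 1) k i j i' j'
  · -- `(P, Q) = (-Λ, -Λ)`: `v = (k+1, i, j+Λ)`, `v' = (k, i+Λ, j)` with `Λ = -s k`, i.e. `v = (k+1, i, j - s k)`, `v' = (k, i - s k, j)`
    refine ⟨barlowPos 1 hB s (k + 1) i (j - s k), barlowPos 1 hB s k (i - s k) j, barlowPos_mem _ _ _, barlowPos_mem _ _ _,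
      ?_, ?_, ?_, ?_, ?_⟩
    · rw [dist_barlowPos_eq_iff hs one_pos hB_sq']
      refine Or.inr (Or.inl ⟨rfl, ?_⟩)
      rw [show i - i = 0 by ring, show j - (j - s k) = s k by ring]
      rcases hs k with h | h <;> rw [h] <;> decide
    · rw [dist_barlowPos_eq_iff hs one_pos hB_sq']
      refine Or.inl ⟨rfl, ?_⟩
      have e1 : i' - i = -s k := by omega
      have e2 : j' - (j - s k) = 0 := by omega
      rw [e1, e2]; rcases hs k with h | h <;> rw [h] <;> decide
    · rw [dist_barlowPos_eq_iff hs one_pos hB_sq']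
      refine Or.inl ⟨rfl, ?_⟩
      rw [show i - (i - s k) = s k by ring, show j - j = 0 by ring]
      rcases hs k with h | h <;> rw [h] <;> decide
    · rw [dist_barlowPos_eq_iff hs one_pos hB_sq']
      refine Or.inr (Or.inr ⟨by ring, ?_⟩)
      have e1 : i' - (i - s k) = 0 := by omega
      have e2 : j' - j = -s k := by omega
      rw [e1, e2, hsk]; rcases hs k with h | h <;> rw [h] <;> decide
    · rw [barlowPos_add_swap s (k + 1) k i (j - s k) (i - s k) j]
      exact barlowPos_add_eq_of_index_sums s k (k + 1) (by omega) (by omega)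

/-- **The octahedron lemma** (coordinates): two sites at distance `√2` have two common nearest neighbours `v, v'` with `v + v' = a + b`. -/
theorem exists_common_neighbours_barlowPos {s : ℤ → ℤ} (hs : IsHaggSeq s) (k i j k' i' j' : ℤ)
    (hd : dist (barlowPos 1 hB s k i j) (barlowPos 1 hB s k' i' j') = Real.sqrt 2) :
    ∃ v v' : E3, v ∈ barlowStacking 1 hB s ∧ v' ∈ barlowStacking 1 hB s ∧
      dist (barlowPos 1 hB s k i j) v = 1 ∧ dist (barlowPos 1 hB s k' i' j') v = 1 ∧
      dist (barlowPos 1 hB s k i j) v' = 1 ∧ dist (barlowPos 1 hB s k' i' j') v' = 1 ∧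
      v + v' = barlowPos 1 hB s k i j + barlowPos 1 hB s k' i' j' := by
  -- the form is `24`, so `|k - k'| = 1`
  have h12 := twelve_mul_dist_barlowPos_sq hB_sq' s k i j k' i' j'
  rw [one_pow, one_mul, hd, Real.sq_sqrt (by norm_num : (0:ℝ) ≤ 2)] at h12
  have hF : 3 * (2 * (i - i') + (j - j') + (haggLabel s k - haggLabel s k')) ^ 2 +
      (3 * (j - j') + (haggLabel s k - haggLabel s k')) ^ 2 + 8 * (k - k') ^ 2 = (24 : ℤ) := by
    exact_mod_cast h12.symm
  have hK3 : (k - k') ^ 2 ≤ 3 := by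
    nlinarith [sq_nonneg (2 * (i - i') + (j - j') + (haggLabel s k - haggLabel s k')),
      sq_nonneg (3 * (j - j') + (haggLabel s k - haggLabel s k'))]
  have hK1 : k - k' ≤ 1 := by nlinarith
  have hK1' : -1 ≤ k - k' := by nlinarith
  have hK0 : k - k' ≠ 0 := by
    intro hK
    have hk' : k' = k := by omega
    subst hk'
    simp only [sub_self, add_zero] at hF
    norm_num at hF
    have hPQ : i - i' ≠ 0 ∨ j - j' ≠ 0 := by
      by_contra h0; push Not at h0
      rw [h0.1, h0.2] at hF; norm_num at hF
    rcases inLayer_form_eq_twelve_or_le hPQ with h | h <;> omega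
  rcases (show k' = k + 1 ∨ k' = k - 1 by omega) with hk' | hk'
  · subst hk'
    exact exists_common_neighbours_succ hs k i j i' j' hd
  · -- `k = k' + 1`: apply the previous case to `(b, a)` and swap the roles
    have hk : k = k' + 1 := by omega
    subst hk
    rw [dist_comm] at hd
    obtain ⟨v, v', hv, hv', h1, h2, h3, h4, h5⟩ := exists_common_neighbours_succ hs k' i' j' i j hd
    exact ⟨v, v', hv, hv', h2, h1, h4, h3, by rw [h5, add_comm]⟩

/-- **The octahedron lemma, moved**: two sites of `stacking L s σ` at distance `√2` have two common nearest neighbours `v, v'` in the stacking with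
`v + v' = a + b` (an antipodal pair of the equatorial square of the octahedron with poles `a, b`). -/
theorem exists_common_neighbours_of_dist_eq_sqrt_two {σ : ℤ → ℤ} (hσ : IsHaggSeq σ) {L : E3 ≃ₗᵢ[ℝ] E3} {s : E3} {a b : E3}
    (ha : a ∈ stacking L s σ) (hb : b ∈ stacking L s σ) (hd : dist a b = Real.sqrt 2) :
    ∃ v v' : E3, v ∈ stacking L s σ ∧ v' ∈ stacking L s σ ∧ dist a v = 1 ∧ dist b v = 1 ∧ dist a v' = 1 ∧ dist b v' = 1 ∧
      v + v' = a + b := by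
  obtain ⟨r, hr, rfl⟩ : a ∈ (fun r => L r + s) '' barlowStacking 1 hB σ := ha
  obtain ⟨r', hr', rfl⟩ : b ∈ (fun r => L r + s) '' barlowStacking 1 hB σ := hb
  obtain ⟨k, i, j, rfl⟩ := mem_barlowStacking_iff.1 hr
  obtain ⟨k', i', j', rfl⟩ := mem_barlowStacking_iff.1 hr'
  rw [dist_move] at hd
  obtain ⟨v, v', hv, hv', h1, h2, h3, h4, h5⟩ := exists_common_neighbours_barlowPos hσ k i j k' i' j' hd
  refine ⟨L v + s, L v' + s, ⟨v, hv, rfl⟩, ⟨v', hv', rfl⟩, by rw [dist_move, h1], by rw [dist_move, h2], by rw [dist_move, h3],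
    by rw [dist_move, h4], ?_⟩
  have h5' : L v + L v' = L (barlowPos 1 hB σ k i j) + L (barlowPos 1 hB σ k' i' j') := by rw [← map_add, h5, map_add]
  calc L v + s + (L v' + s) = (L v + L v') + (s + s) := by abel
    _ = (L (barlowPos 1 hB σ k i j) + L (barlowPos 1 hB σ k' i' j')) + (s + s) := by rw [h5']
    _ = L (barlowPos 1 hB σ k i j) + s + (L (barlowPos 1 hB σ k' i' j') + s) := by abel

end Summit.Ventures.Crystal3D.Cruxes.TextureLiminf.TexShadow

end
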